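import Summits.PneNP.PneNP.Theorems.ChebyshevTracialDesignTwoBlockExpansion
import Summits.PneNP.PneNP.Theorems.ChebyshevTracialDesignTwoBlockArith
import HarnessLib

/-!
# Cell pnp-psdrank, route `ChebyshevTracialDesign`: TILTED TWO SMALL BLOCKS — one class priced in every two-block crossing-plane
# direction (brick 158; crux `TracialDecayExp20`, stmt-PneNP-19878)

Brick 158 (prover g31; MEMO-33 §5 rev 2, MEMO-34 §2). THE PER-CLASS STATEMENT OF THE TILTED TWO-SMALL-BLOCK LINE, the two-block
companion of brick 151 (`…TiltedSmallBlock`). After the class split of two disjoint small blocks `H₁, H₂` at a matching (brick 159: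
the internal edges `V(AA(H₁ ∪ H₂))` conditioned on), every class lives on a `π`-stable reduced ground set `S` with NO edge inside
`H₁ ∪ H₂`, the (CG_1′) containment form of a bivariate mask `Ψ(|U∩H₁|, |U∩H₂|)` in a COLOUR-TYPE-CONSTANT direction is the two-block
crossing-plane form `Ψ(X₁,X₂)·(2λ₁(X₁−Y₁) + 2λ₂(X₂−Y₂) + L − κc)²` (`λ_i = u_{i,out} − u_{out,out}`), weighted by a class polynomial:

* **`tiltedTwoBlocks_levelSum_le`** — exact design (its rule), stable `S` with `N'` edges, disjoint `H₁, H₂` with no edge of `S`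
  inside `H₁ ∪ H₂` and `b` edges meeting it, reduced cut `2s₀+c₀`, shift `g ≤ T`, base `2i₀+1 = g+c₀`, `R ≥ 1`,
  `R + 3(D′+1) + b + (T−1)/2 ≤ s₀`, `R + 3(D′+1) + b + s₀ + (T−1)/2 + 2 ≤ N'`, `(b/R)²e^{3b/R} ≤ 2`, `0 ≤ Ψ ≤ G`, `|λ_i| ≤ 2`, `|κ| ≤ 1`,
  `|L| ≤ L₀`, weight `p` with `deg p + 2 + D′ ≤ D`, `p(0) ≥ 0`, `p(0) = 0` unless `g = 0`, `p = 0` on levels `< g`, `|p| ≤ P`: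
  `Σ_c w_c p(c)·E_{Shell_S(2s₀+c₀,c−g)}[Ψ(X₁,X₂)(2λ₁(X₁−Y₁)+2λ₂(X₂−Y₂)+L−κc)²] ≤ B_v·P·C((T−1)/2,D′+1)·G·(4(b+2)+L₀+9T+4)²·q_b^{D′+1}`
  (`q_b = ¼(b/R)²e^{3b/R}`; the amplitude is bounded on `x₁ + x₂ ≤ b + 2`, whence `4(b+2)` in place of brick 151's `4(2s₀+c₀)`).
  Proof: 158b `levelSum_tilted_expand₂` ∘ 158a `piece_main_le₂` (main piece, `g = 0`) / `piece_abs_le₂` (eleven pieces whose weights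
  vanish at the virtual level and below their base by PARITY) on `S`, `S∖e_v`, `S∖e_v∖e_w`; 158c `twelve_piece_bound`.
WHAT THIS FILE DOES NOT DO: the class split on `[n]` (159), the `M`-average (160), non-type-constant directions; anything on
`TracialDecayExp20` itself, psd rank of P_PM(K_n), or P vs NP. [cite: Rothvoss2017, §2 (PDF p. 6)]
[cite: Agarwal2000DifferenceEquations, Remark 1.8.1 (1.8.8)] [cite: RollinRoss2010, §3 (Lemma 3.1)]
Stature: support/instrument (kernel lane, no defs, axioms standard; one `maxHeartbeats 400000`). Supports stmt-PneNP-19878.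
-/

set_option linter.dupNamespace false -- `Summit.PneNP.PneNP.…`: summit = sub-problem (D-0017)

noncomputable section

namespace Summit.PneNP.PneNP.Theorems.ChebyshevTracialDesignTwoBlock

open Finset Polynomial Literature.Barriers.PneNP Literature.Combinatorics.Optimization
open Literature.Combinatorics.Optimization.ShellStep
open Summit.PneNP.PneNP.Theorems.ChebyshevTracialDesignTiltedSmallBlockTools (shellIn_nonempty_of_add_le)
open Summit.PneNP.PneNP.Theorems.ChebyshevTracialDesignTiltedSmallBlockExpansion
  (abs_div_mul_sum_le abs_div_mul_sum_sum_le weights_natDegree_le weights_abs_eval_le)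
open Summit.PneNP.PneNP.Theorems.ChebyshevTracialDesignTwoBlockTools (piece_abs_le₂ piece_main_le₂)
open Summit.PneNP.PneNP.Theorems.ChebyshevTracialDesignTwoBlockExpansion (levelSum_tilted_expand₂ mask_bounds pinned_ground_sets)
open Summit.PneNP.PneNP.Theorems.ChebyshevTracialDesignTwoBlockArith

variable {n : ℕ}

section Main

variable {π : Fin n → Fin n} (hπ : ∀ v, π (π v) = v) (hπ' : ∀ v, π v ≠ v)
include hπ hπ'

set_option maxHeartbeats 400000 in
/-- **TILTED TWO SMALL BLOCKS, ONE CLASS: THE TWO-BLOCK CROSSING-PLANE FORM PRICED (brick 158).** Exact design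
`(n,t,T,D,B_v,C,w)` (only its rule is used); a `π`-stable ground set `S` with `N'` edges; DISJOINT blocks `H₁, H₂` with NO edge
of `S` inside `H₁ ∪ H₂` and `b` edges meeting it; the reduced cut `2s₀+c₀` (`c₀ ≤ 1`), a level shift `g ≤ T` and base `i₀` with
`2i₀+1 = g+c₀`; `R ≥ 1`, `R + 3(D′+1) + b + (T−1)/2 ≤ s₀`, `R + 3(D′+1) + b + s₀ + (T−1)/2 + 2 ≤ N'`, `(b/R)²e^{3b/R} ≤ 2`; a
bivariate mask `0 ≤ Ψ ≤ G`; data `|λ₁|, |λ₂| ≤ 2`, `|κ| ≤ 1`, `|L| ≤ L₀`; a polynomial level weight `p` with `deg p + 2 + D′ ≤ D`,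
`p(0) ≥ 0`, `p(0) = 0` unless `g = 0`, `p(c) = 0` on the levels `c < g`, `|p| ≤ P` on the levels. Then
`Σ_c w_c p(c)·E_{Shell_S(2s₀+c₀, c−g)}[Ψ(X₁,X₂)·(2λ₁(X₁−Y₁) + 2λ₂(X₂−Y₂) + L − κc)²]`
`≤ B_v·P·C((T−1)/2, D′+1)·G·(4(b+2)+L₀+9T+4)²·(¼(b/R)²e^{3b/R})^{D′+1}` (`X_i = |U∩H_i|`, `Y_i = |half U ∩ H_i|`). Twelve pieces
(brick 158b): the main piece `Ψ·(2λ₁X₁+2λ₂X₂+L)²` one-sidedly (158a `piece_main_le₂`) when `g = 0`, pure remainder otherwise; the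
eleven others are pure remainders on `S`, `S∖e_v`, `S∖e_v∖e_w` (158a `piece_abs_le₂`: bivariate masks average to their
hypergeometric mixtures, brick 157b). [cite: Rothvoss2017, §2 (PDF p. 6)] [cite: Agarwal2000DifferenceEquations, Remark 1.8.1 (1.8.8)]
[cite: RollinRoss2010, §3 (Lemma 3.1)] -/
theorem tiltedTwoBlocks_levelSum_le {t T D : ℕ} {Bv : ℝ} {C : Finset ℕ} {w : ℕ → ℝ}
    (hdes : IsExactDesign n t T D Bv C w)
    {S : Finset (Fin n)} (hS : ∀ v ∈ S, π v ∈ S) {N' : ℕ} (hN : S.card = 2 * N')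
    {H₁ H₂ : Finset (Fin n)} (hdisj : Disjoint H₁ H₂) (h0 : (reps π (vAA π S (H₁ ∪ H₂))).card = 0)
    {b : ℕ} (hb : (reps π (vBH π S (H₁ ∪ H₂) ∪ vBN π S (H₁ ∪ H₂))).card = b)
    {s₀ c₀ i₀ g D' R : ℕ} (hc₀ : c₀ ≤ 1) (hi₀ : 2 * i₀ + 1 = g + c₀) (hgT : g ≤ T) (hR : 1 ≤ R)
    (hR1 : R + 3 * (D' + 1) + b + (T - 1) / 2 ≤ s₀)
    (hR2 : R + 3 * (D' + 1) + b + s₀ + (T - 1) / 2 + 2 ≤ N')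
    (hq : ((b : ℝ) / R) ^ 2 * Real.exp (3 * b / R) ≤ 2)
    (Ψ : ℤ → ℤ → ℝ) {G : ℝ} (hG : ∀ x₁ x₂ : ℤ, |Ψ x₁ x₂| ≤ G) (hΨ0 : ∀ x₁ x₂ : ℤ, 0 ≤ Ψ x₁ x₂)
    (l₁ l₂ kap L : ℝ) {L₀ : ℝ} (hl₁ : |l₁| ≤ 2) (hl₂ : |l₂| ≤ 2) (hkap : |kap| ≤ 1) (hL : |L| ≤ L₀)
    (p : ℝ[X]) (hdeg : p.natDegree + 2 + D' ≤ D) (hp0 : 0 ≤ p.eval 0) (hpg : g ≠ 0 → p.eval 0 = 0)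
    (hpC : ∀ c ∈ C, c < g → p.eval (c : ℝ) = 0) {P : ℝ} (hP : ∀ c ∈ C, |p.eval (c : ℝ)| ≤ P) :
    ∑ c ∈ C, w c * (p.eval (c : ℝ) *
        ((∑ U ∈ shellIn π S (2 * s₀ + c₀) (c - g), Ψ ((U ∩ H₁).card : ℤ) ((U ∩ H₂).card : ℤ) *
            (2 * l₁ * (((U ∩ H₁).card : ℝ) - ((half π U ∩ H₁).card : ℝ)) +
              2 * l₂ * (((U ∩ H₂).card : ℝ) - ((half π U ∩ H₂).card : ℝ)) + L - kap * c) ^ 2) /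
          ((shellIn π S (2 * s₀ + c₀) (c - g)).card : ℝ))) ≤
      Bv * P * ((((T - 1) / 2).choose (D' + 1) : ℕ) : ℝ) *
        (G * (4 * ((b + 2 : ℕ) : ℝ) + L₀ + 9 * T + 4) ^ 2 *
          ((1 / 4 : ℝ) * ((b : ℝ) / R) ^ 2 * Real.exp (3 * b / R)) ^ (D' + 1)) := by
  classical
  -- basic facts
  set q : ℝ := (1 / 4 : ℝ) * ((b : ℝ) / R) ^ 2 * Real.exp (3 * b / R) with hqdef
  have hq0 : 0 ≤ q := by rw [hqdef]; positivity
  set Kc : ℝ := ((((T - 1) / 2).choose (D' + 1) : ℕ) : ℝ) with hKc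
  have hKc0 : 0 ≤ Kc := Nat.cast_nonneg _
  have hG0 : 0 ≤ G := (abs_nonneg _).trans (hG 0 0)
  have hBv : 0 ≤ Bv := (sum_nonneg fun c _ => abs_nonneg (w c)).trans hdes.variation_le
  obtain ⟨c₁, hc₁⟩ : C.Nonempty := by
    by_contra h
    have := hdes.2.2.2.2.1
    rw [not_nonempty_iff_eq_empty.1 h, sum_empty] at this
    exact zero_ne_one this
  have hP0 : 0 ≤ P := (abs_nonneg _).trans (hP c₁ hc₁)
  have hlev : ∀ c ∈ C, (∃ j, c = 2 * j + 1) ∧ 3 ≤ c ∧ c ≤ T := by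
    intro c hc
    obtain ⟨hodd, h3, hcT, _⟩ := hdes.2.2.2.1 c hc
    exact ⟨hodd.imp fun j hj => by omega, h3, hcT⟩
  have hT0 : (0 : ℝ) ≤ T := Nat.cast_nonneg T
  have hnoHH := noHH_of_card_reps_vAA_eq_zero hπ hπ' hS (H₁ ∪ H₂) h0
  have hsep : ∀ v ∈ S ∩ H₁, ∀ w' ∈ S ∩ H₂, w' ≠ v ∧ w' ≠ π v := by
    intro v hv w' hw'
    refine ⟨fun e => disjoint_left.1 hdisj (mem_inter.1 hv).2 (e ▸ (mem_inter.1 hw').2), fun e => ?_⟩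
    exact hnoHH v (mem_inter.1 hv).1 ⟨mem_union_left _ (mem_inter.1 hv).2, e ▸ mem_union_right _ (mem_inter.1 hw').2⟩
  have hScard : (4 : ℝ) ≤ S.card := by exact_mod_cast (show 4 ≤ S.card by omega)
  have hL₀ : 0 ≤ L₀ := (abs_nonneg _).trans hL
  set Λ₁ : ℝ := 4 * ((b + 2 : ℕ) : ℝ) + L₀ with hΛ₁
  have hΛ₁0 : 0 ≤ Λ₁ := by rw [hΛ₁]; positivity
  -- masks
  have hA : ∀ x₁ x₂ : ℕ, x₁ + x₂ ≤ b + 2 →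
      |2 * l₁ * ((x₁ : ℤ) : ℝ) + 2 * l₂ * ((x₂ : ℤ) : ℝ) + L| ≤ Λ₁ := by
    intro x₁ x₂ hx
    exact amplitude_abs_le hl₁ hl₂ hL (by positivity) (by positivity) (by exact_mod_cast hx)
  obtain ⟨hM2, hM2', hM1, hM1a, hM1b⟩ := mask_bounds Ψ hG hΨ0 hA
  have hM0 : ∀ x₁ x₂ : ℕ, x₁ + x₂ ≤ b → |Ψ x₁ x₂| ≤ G := fun x₁ x₂ _ => hG _ _
  -- nonempty shells at the levels `c ≥ g + 1`
  have hne : ∀ c ∈ C, g + 1 ≤ c → (shellIn π S (2 * s₀ + c₀) (c - g)).Nonempty := by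
    intro c hc hgc
    obtain ⟨⟨j, rfl⟩, _, hcT⟩ := hlev c hc
    have h := shellIn_nonempty_of_add_le hπ hπ' hS hN (s := s₀ + i₀ - j) (c := 2 * j + 1 - g) (by omega)
    rwa [show 2 * (s₀ + i₀ - j) + (2 * j + 1 - g) = 2 * s₀ + c₀ by omega] at h
  -- a level below the base is not a design level (parity)
  have hbase : ∀ c ∈ C, c < g + c₀ → p.eval (c : ℝ) = 0 := by
    intro c hc hlt
    obtain ⟨⟨j, rfl⟩, _, _⟩ := hlev c hc
    rcases lt_or_ge (2 * j + 1) g with h | h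
    · exact hpC _ hc h
    · exfalso; omega
  have hp0g : p.eval 0 * (g : ℝ) = 0 := by
    rcases Nat.eq_zero_or_pos g with h | h
    · rw [h, Nat.cast_zero, mul_zero]
    · rw [hpg (by omega), zero_mul]
  -- degrees and level bounds of the five derived weights
  obtain ⟨hdX, hdX2, hdg, hdXg, hdgg⟩ := weights_natDegree_le p (g : ℝ) ((g : ℝ) + 1) hdeg
  have hgT' : (g : ℝ) ≤ T := by exact_mod_cast hgT
  obtain ⟨hPX, hPX2, hPg, hPXg, hPgg⟩ := weights_abs_eval_le p C hP hP0 (Nat.cast_nonneg g) hgT'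
    (fun c hc => by obtain ⟨_, h3, hcT⟩ := hlev c hc; exact ⟨by exact_mod_cast h3, by exact_mod_cast hcT⟩)
  -- expand
  have ht2 : 2 ≤ 2 * s₀ + c₀ := by omega
  rw [levelSum_tilted_expand₂ hπ hπ' hS hdisj hsep ht2 g C w p hpC hne Ψ l₁ l₂ kap L]
  -- ground-set data of the deleted instances
  obtain ⟨hSv, hSvw⟩ := pinned_ground_sets hπ hπ' hS hN (H₁ ∪ H₂) h0 hb
  have hpair₁ : ∀ v ∈ S ∩ H₁, ∀ w' ∈ (S ∩ H₁) \ {v, π v}, v ∈ S ∧ w' ∈ S ∧ w' ≠ v ∧ w' ≠ π v := by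
    intro v hv w' hw'
    rw [mem_sdiff, mem_inter, mem_insert, mem_singleton, not_or] at hw'
    exact ⟨(mem_inter.1 hv).1, hw'.1.1, hw'.2.1, hw'.2.2⟩
  have hpair₂ : ∀ v ∈ S ∩ H₂, ∀ w' ∈ (S ∩ H₂) \ {v, π v}, v ∈ S ∧ w' ∈ S ∧ w' ≠ v ∧ w' ≠ π v := by
    intro v hv w' hw'
    rw [mem_sdiff, mem_inter, mem_insert, mem_singleton, not_or] at hw'
    exact ⟨(mem_inter.1 hv).1, hw'.1.1, hw'.2.1, hw'.2.2⟩
  -- the reduced cut one vertex down: `2s₀ + c₀ − 1 = 2s₁ + c₁`, base `i₁`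
  obtain ⟨s₁, c₁, i₁, hs₁, hi₁, hc₁, hs₁le⟩ : ∃ s₁ c₁ i₁ : ℕ, 2 * s₀ + c₀ - 1 = 2 * s₁ + c₁ ∧
      2 * i₁ + 1 = g + 1 + c₁ ∧ c₁ ≤ 1 ∧ s₁ ≤ s₀ ∧ s₀ ≤ s₁ + 1 := by
    rcases Nat.eq_zero_or_pos c₀ with h | h
    · exact ⟨s₀ - 1, 1, i₀ + 1, by omega, by omega, le_rfl, by omega, by omega⟩
    · exact ⟨s₀, 0, i₀, by omega, by omega, by omega, le_rfl, by omega⟩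
  have hi₂ : 2 * (i₀ + 1) + 1 = (g + 2) + c₀ := by omega
  -- derived weights: virtual vanishing and bases
  have hwg0 : (p * (X - Polynomial.C (g : ℝ))).eval 0 = 0 := by
    rw [eval_mul, eval_sub, eval_X, eval_C, zero_sub, mul_neg, hp0g, neg_zero]
  have hwXg0 : (p * X * (X - Polynomial.C (g : ℝ))).eval 0 = 0 := by simp
  have hbase1 : ∀ c ∈ C, c < 2 * i₁ + 1 → (p * (X - Polynomial.C (g : ℝ))).eval (c : ℝ) = 0 := by
    intro c hc hlt
    obtain ⟨⟨j, rfl⟩, _, _⟩ := hlev c hc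
    rcases lt_trichotomy (2 * j + 1) g with h | h | h
    · rw [eval_mul, hpC _ hc h, zero_mul]
    · rw [eval_mul, eval_sub, eval_X, eval_C, ← h]; push_cast; ring
    · exfalso; omega
  have hbase1' : ∀ c ∈ C, c < 2 * i₁ + 1 → (p * X * (X - Polynomial.C (g : ℝ))).eval (c : ℝ) = 0 := by
    intro c hc hlt
    have h := hbase1 c hc hlt
    rw [eval_mul] at h
    rw [eval_mul, eval_mul, eval_X, mul_assoc, mul_comm (c : ℝ), ← mul_assoc, h, zero_mul]
  have hwgg0 : (p * (X - Polynomial.C (g : ℝ)) * (X - Polynomial.C ((g : ℝ) + 1))).eval 0 = 0 := by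
    rw [eval_mul, hwg0, zero_mul]
  have hbase2 : ∀ c ∈ C, c < 2 * (i₀ + 1) + 1 →
      (p * (X - Polynomial.C (g : ℝ)) * (X - Polynomial.C ((g : ℝ) + 1))).eval (c : ℝ) = 0 := by
    intro c hc hlt
    obtain ⟨⟨j, rfl⟩, _, _⟩ := hlev c hc
    rcases lt_trichotomy (2 * j + 1) (g + 1) with h | h | h
    · rw [eval_mul, hbase1 _ hc (by omega), zero_mul]
    · rw [eval_mul, eval_sub, eval_X, eval_C, show ((2 * j + 1 : ℕ) : ℝ) = (g : ℝ) + 1 by exact_mod_cast h]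
      ring
    · exfalso; omega
  -- === T0: the main piece
  have hB0 : ∑ c ∈ C, w c * (p.eval (c : ℝ) *
      ((∑ U ∈ shellIn π S (2 * s₀ + c₀) (c - g),
          (fun y₁ y₂ : ℤ => Ψ y₁ y₂ * (2 * l₁ * (y₁ : ℝ) + 2 * l₂ * (y₂ : ℝ) + L) ^ 2)
            ((U ∩ H₁).card : ℤ) ((U ∩ H₂).card : ℤ)) /
        ((shellIn π S (2 * s₀ + c₀) (c - g)).card : ℝ))) ≤ Bv * P * Kc * (G * Λ₁ ^ 2 * q ^ (D' + 1)) := by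
    rcases Nat.eq_zero_or_pos g with hg0 | hgpos
    · subst hg0
      have hc₀1 : c₀ = 1 := by omega
      subst hc₀1
      simp only [Nat.sub_zero]
      have h := piece_main_le₂ hπ hπ' hdes hS hN hdisj h0 hb le_rfl (s₀ := s₀) (D' := D') hR (by omega) (by omega) hq
        (fun y₁ y₂ : ℤ => Ψ y₁ y₂ * (2 * l₁ * (y₁ : ℝ) + 2 * l₂ * (y₂ : ℝ) + L) ^ 2) hM2 hM2' p (by omega) hp0 hP
      rw [← hqdef, ← hKc] at h
      exact h
    · have hpz : p.eval 0 = 0 := hpg (by omega)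
      have h := piece_abs_le₂ hπ hπ' hdes hS hN hdisj h0 hb le_rfl (s₀ := s₀) (D' := D') hi₀ hR (by omega) (by omega)
        (fun y₁ y₂ : ℤ => Ψ y₁ y₂ * (2 * l₁ * (y₁ : ℝ) + 2 * l₂ * (y₂ : ℝ) + L) ^ 2) hM2 p (by omega) hpz (fun c hc hlt => hbase c hc (by omega)) hP
      rw [← hqdef, ← hKc] at h
      exact (le_abs_self _).trans h
  -- === T1, T2: plain pieces with weights `p·c`, `p·c²`
  have hB1 : |∑ c ∈ C, w c * ((p * X).eval (c : ℝ) *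
      ((∑ U ∈ shellIn π S (2 * s₀ + c₀) (c - g),
          (fun y₁ y₂ : ℤ => Ψ y₁ y₂ * (2 * l₁ * (y₁ : ℝ) + 2 * l₂ * (y₂ : ℝ) + L))
            ((U ∩ H₁).card : ℤ) ((U ∩ H₂).card : ℤ)) /
        ((shellIn π S (2 * s₀ + c₀) (c - g)).card : ℝ)))| ≤ Bv * (P * T) * Kc * (G * Λ₁ * q ^ (D' + 1)) := by
    have h := piece_abs_le₂ hπ hπ' hdes hS hN hdisj h0 hb le_rfl (s₀ := s₀) (D' := D') hi₀ hR (by omega) (by omega)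
      (fun y₁ y₂ : ℤ => Ψ y₁ y₂ * (2 * l₁ * (y₁ : ℝ) + 2 * l₂ * (y₂ : ℝ) + L)) hM1 (p * X) hdX (by simp) (fun c hc hlt => by rw [eval_mul, hbase c hc (by omega), zero_mul]) hPX
    rw [← hqdef, ← hKc] at h
    exact h
  have hB2 : |∑ c ∈ C, w c * ((p * X ^ 2).eval (c : ℝ) *
      ((∑ U ∈ shellIn π S (2 * s₀ + c₀) (c - g), Ψ ((U ∩ H₁).card : ℤ) ((U ∩ H₂).card : ℤ)) /
        ((shellIn π S (2 * s₀ + c₀) (c - g)).card : ℝ)))| ≤ Bv * (P * T ^ 2) * Kc * (G * q ^ (D' + 1)) := by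
    have h := piece_abs_le₂ hπ hπ' hdes hS hN hdisj h0 hb le_rfl (s₀ := s₀) (D' := D') hi₀ hR (by omega) (by omega)
      Ψ hM0 (p * X ^ 2) hdX2 (by simp) (fun c hc hlt => by rw [eval_mul, hbase c hc (by omega), zero_mul]) hPX2
    rw [← hqdef, ← hKc] at h
    exact h
  -- === one half vertex pinned (ground set `S ∖ e_v`, cut `2s₁+c₁`, shift `g+1`, base `i₁`), blocks 1 and 2
  have hB3 : ∀ v ∈ S ∩ H₁, |∑ c ∈ C, w c * ((p * (X - Polynomial.C (g : ℝ))).eval (c : ℝ) *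
      ((∑ W ∈ shellIn π (S \ {v, π v}) (2 * s₀ + c₀ - 1) (c - g - 1),
          (fun y₁ y₂ : ℤ => Ψ (y₁ + 1) y₂ * (2 * l₁ * ((y₁ + 1 : ℤ) : ℝ) + 2 * l₂ * (y₂ : ℝ) + L))
            ((W ∩ H₁).card : ℤ) ((W ∩ H₂).card : ℤ)) /
        ((shellIn π (S \ {v, π v}) (2 * s₀ + c₀ - 1) (c - g - 1)).card : ℝ)))| ≤
      Bv * (P * T) * Kc * (G * Λ₁ * q ^ (D' + 1)) := by
    intro v hv
    obtain ⟨hst, hcard, h0v, hbv⟩ := hSv v (mem_inter.1 hv).1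
    have h := piece_abs_le₂ hπ hπ' hdes hst hcard hdisj h0v rfl hbv (s₀ := s₁) (D' := D') hi₁ hR (by omega) (by omega)
      (fun y₁ y₂ : ℤ => Ψ (y₁ + 1) y₂ * (2 * l₁ * ((y₁ + 1 : ℤ) : ℝ) + 2 * l₂ * (y₂ : ℝ) + L)) hM1a (p * (X - Polynomial.C (g : ℝ))) hdg hwg0 hbase1 hPg
    rw [← hqdef, ← hKc, ← hs₁] at h
    simp only [Nat.sub_sub] at h ⊢
    exact h
  have hB3' : ∀ v ∈ S ∩ H₂, |∑ c ∈ C, w c * ((p * (X - Polynomial.C (g : ℝ))).eval (c : ℝ) *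
      ((∑ W ∈ shellIn π (S \ {v, π v}) (2 * s₀ + c₀ - 1) (c - g - 1),
          (fun y₁ y₂ : ℤ => Ψ y₁ (y₂ + 1) * (2 * l₁ * (y₁ : ℝ) + 2 * l₂ * ((y₂ + 1 : ℤ) : ℝ) + L))
            ((W ∩ H₁).card : ℤ) ((W ∩ H₂).card : ℤ)) /
        ((shellIn π (S \ {v, π v}) (2 * s₀ + c₀ - 1) (c - g - 1)).card : ℝ)))| ≤
      Bv * (P * T) * Kc * (G * Λ₁ * q ^ (D' + 1)) := by
    intro v hv
    obtain ⟨hst, hcard, h0v, hbv⟩ := hSv v (mem_inter.1 hv).1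
    have h := piece_abs_le₂ hπ hπ' hdes hst hcard hdisj h0v rfl hbv (s₀ := s₁) (D' := D') hi₁ hR (by omega) (by omega)
      (fun y₁ y₂ : ℤ => Ψ y₁ (y₂ + 1) * (2 * l₁ * (y₁ : ℝ) + 2 * l₂ * ((y₂ + 1 : ℤ) : ℝ) + L)) hM1b (p * (X - Polynomial.C (g : ℝ))) hdg hwg0 hbase1 hPg
    rw [← hqdef, ← hKc, ← hs₁] at h
    simp only [Nat.sub_sub] at h ⊢
    exact h
  have hB4 : ∀ v ∈ S ∩ H₁, |∑ c ∈ C, w c * ((p * X * (X - Polynomial.C (g : ℝ))).eval (c : ℝ) *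
      ((∑ W ∈ shellIn π (S \ {v, π v}) (2 * s₀ + c₀ - 1) (c - g - 1),
          (fun x₁ x₂ : ℤ => Ψ (x₁ + 1) x₂) ((W ∩ H₁).card : ℤ) ((W ∩ H₂).card : ℤ)) /
        ((shellIn π (S \ {v, π v}) (2 * s₀ + c₀ - 1) (c - g - 1)).card : ℝ)))| ≤
      Bv * (P * T ^ 2) * Kc * (G * q ^ (D' + 1)) := by
    intro v hv
    obtain ⟨hst, hcard, h0v, hbv⟩ := hSv v (mem_inter.1 hv).1
    have h := piece_abs_le₂ hπ hπ' hdes hst hcard hdisj h0v rfl hbv (s₀ := s₁) (D' := D') hi₁ hR (by omega) (by omega)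
      (fun x₁ x₂ : ℤ => Ψ (x₁ + 1) x₂) (fun _ _ _ => hG _ _) (p * X * (X - Polynomial.C (g : ℝ))) hdXg hwXg0 hbase1' hPXg
    rw [← hqdef, ← hKc, ← hs₁] at h
    simp only [Nat.sub_sub] at h ⊢
    exact h
  have hB5 : ∀ v ∈ S ∩ H₁, |∑ c ∈ C, w c * ((p * (X - Polynomial.C (g : ℝ))).eval (c : ℝ) *
      ((∑ W ∈ shellIn π (S \ {v, π v}) (2 * s₀ + c₀ - 1) (c - g - 1),
          (fun x₁ x₂ : ℤ => Ψ (x₁ + 1) x₂) ((W ∩ H₁).card : ℤ) ((W ∩ H₂).card : ℤ)) /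
        ((shellIn π (S \ {v, π v}) (2 * s₀ + c₀ - 1) (c - g - 1)).card : ℝ)))| ≤
      Bv * (P * T) * Kc * (G * q ^ (D' + 1)) := by
    intro v hv
    obtain ⟨hst, hcard, h0v, hbv⟩ := hSv v (mem_inter.1 hv).1
    have h := piece_abs_le₂ hπ hπ' hdes hst hcard hdisj h0v rfl hbv (s₀ := s₁) (D' := D') hi₁ hR (by omega) (by omega)
      (fun x₁ x₂ : ℤ => Ψ (x₁ + 1) x₂) (fun _ _ _ => hG _ _) (p * (X - Polynomial.C (g : ℝ))) hdg hwg0 hbase1 hPg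
    rw [← hqdef, ← hKc, ← hs₁] at h
    simp only [Nat.sub_sub] at h ⊢
    exact h
  have hB6 : ∀ v ∈ S ∩ H₁, ∀ w' ∈ (S ∩ H₁) \ {v, π v},
      |∑ c ∈ C, w c * ((p * (X - Polynomial.C (g : ℝ)) * (X - Polynomial.C ((g : ℝ) + 1))).eval (c : ℝ) *
      ((∑ W ∈ shellIn π (del2 π S v w') (2 * s₀ + c₀ - 2) (c - g - 2),
          (fun x₁ x₂ : ℤ => Ψ (x₁ + 2) x₂) ((W ∩ H₁).card : ℤ) ((W ∩ H₂).card : ℤ)) /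
        ((shellIn π (del2 π S v w') (2 * s₀ + c₀ - 2) (c - g - 2)).card : ℝ)))| ≤
      Bv * (P * T ^ 2) * Kc * (G * q ^ (D' + 1)) := by
    intro v hv w' hw'
    obtain ⟨h1, h2, h3, h4⟩ := hpair₁ v hv w' hw'
    obtain ⟨hst, hcard, h0v, hbv⟩ := hSvw v h1 w' h2 h3 h4
    have h := piece_abs_le₂ hπ hπ' hdes hst hcard hdisj h0v rfl hbv (s₀ := s₀ - 1) (D' := D') hi₂ hR (by omega)
      (by omega) (fun x₁ x₂ : ℤ => Ψ (x₁ + 2) x₂) (fun _ _ _ => hG _ _)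
      (p * (X - Polynomial.C (g : ℝ)) * (X - Polynomial.C ((g : ℝ) + 1))) hdgg hwgg0 hbase2 hPgg
    rw [← hqdef, ← hKc, show 2 * (s₀ - 1) + c₀ = 2 * s₀ + c₀ - 2 by omega] at h
    simp only [Nat.sub_sub] at h ⊢
    exact h
  have hB4' : ∀ v ∈ S ∩ H₂, |∑ c ∈ C, w c * ((p * X * (X - Polynomial.C (g : ℝ))).eval (c : ℝ) *
      ((∑ W ∈ shellIn π (S \ {v, π v}) (2 * s₀ + c₀ - 1) (c - g - 1),
          (fun x₁ x₂ : ℤ => Ψ x₁ (x₂ + 1)) ((W ∩ H₁).card : ℤ) ((W ∩ H₂).card : ℤ)) /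
        ((shellIn π (S \ {v, π v}) (2 * s₀ + c₀ - 1) (c - g - 1)).card : ℝ)))| ≤
      Bv * (P * T ^ 2) * Kc * (G * q ^ (D' + 1)) := by
    intro v hv
    obtain ⟨hst, hcard, h0v, hbv⟩ := hSv v (mem_inter.1 hv).1
    have h := piece_abs_le₂ hπ hπ' hdes hst hcard hdisj h0v rfl hbv (s₀ := s₁) (D' := D') hi₁ hR (by omega) (by omega)
      (fun x₁ x₂ : ℤ => Ψ x₁ (x₂ + 1)) (fun _ _ _ => hG _ _) (p * X * (X - Polynomial.C (g : ℝ))) hdXg hwXg0 hbase1' hPXg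
    rw [← hqdef, ← hKc, ← hs₁] at h
    simp only [Nat.sub_sub] at h ⊢
    exact h
  have hB5' : ∀ v ∈ S ∩ H₂, |∑ c ∈ C, w c * ((p * (X - Polynomial.C (g : ℝ))).eval (c : ℝ) *
      ((∑ W ∈ shellIn π (S \ {v, π v}) (2 * s₀ + c₀ - 1) (c - g - 1),
          (fun x₁ x₂ : ℤ => Ψ x₁ (x₂ + 1)) ((W ∩ H₁).card : ℤ) ((W ∩ H₂).card : ℤ)) /
        ((shellIn π (S \ {v, π v}) (2 * s₀ + c₀ - 1) (c - g - 1)).card : ℝ)))| ≤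
      Bv * (P * T) * Kc * (G * q ^ (D' + 1)) := by
    intro v hv
    obtain ⟨hst, hcard, h0v, hbv⟩ := hSv v (mem_inter.1 hv).1
    have h := piece_abs_le₂ hπ hπ' hdes hst hcard hdisj h0v rfl hbv (s₀ := s₁) (D' := D') hi₁ hR (by omega) (by omega)
      (fun x₁ x₂ : ℤ => Ψ x₁ (x₂ + 1)) (fun _ _ _ => hG _ _) (p * (X - Polynomial.C (g : ℝ))) hdg hwg0 hbase1 hPg
    rw [← hqdef, ← hKc, ← hs₁] at h
    simp only [Nat.sub_sub] at h ⊢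
    exact h
  have hB6' : ∀ v ∈ S ∩ H₂, ∀ w' ∈ (S ∩ H₂) \ {v, π v},
      |∑ c ∈ C, w c * ((p * (X - Polynomial.C (g : ℝ)) * (X - Polynomial.C ((g : ℝ) + 1))).eval (c : ℝ) *
      ((∑ W ∈ shellIn π (del2 π S v w') (2 * s₀ + c₀ - 2) (c - g - 2),
          (fun x₁ x₂ : ℤ => Ψ x₁ (x₂ + 2)) ((W ∩ H₁).card : ℤ) ((W ∩ H₂).card : ℤ)) /
        ((shellIn π (del2 π S v w') (2 * s₀ + c₀ - 2) (c - g - 2)).card : ℝ)))| ≤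
      Bv * (P * T ^ 2) * Kc * (G * q ^ (D' + 1)) := by
    intro v hv w' hw'
    obtain ⟨h1, h2, h3, h4⟩ := hpair₂ v hv w' hw'
    obtain ⟨hst, hcard, h0v, hbv⟩ := hSvw v h1 w' h2 h3 h4
    have h := piece_abs_le₂ hπ hπ' hdes hst hcard hdisj h0v rfl hbv (s₀ := s₀ - 1) (D' := D') hi₂ hR (by omega)
      (by omega) (fun x₁ x₂ : ℤ => Ψ x₁ (x₂ + 2)) (fun _ _ _ => hG _ _)
      (p * (X - Polynomial.C (g : ℝ)) * (X - Polynomial.C ((g : ℝ) + 1))) hdgg hwgg0 hbase2 hPgg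
    rw [← hqdef, ← hKc, show 2 * (s₀ - 1) + c₀ = 2 * s₀ + c₀ - 2 by omega] at h
    simp only [Nat.sub_sub] at h ⊢
    exact h
  have hB7 : ∀ v ∈ S ∩ H₁, ∀ w' ∈ S ∩ H₂,
      |∑ c ∈ C, w c * ((p * (X - Polynomial.C (g : ℝ)) * (X - Polynomial.C ((g : ℝ) + 1))).eval (c : ℝ) *
      ((∑ W ∈ shellIn π (del2 π S v w') (2 * s₀ + c₀ - 2) (c - g - 2),
          (fun x₁ x₂ : ℤ => Ψ (x₁ + 1) (x₂ + 1)) ((W ∩ H₁).card : ℤ) ((W ∩ H₂).card : ℤ)) /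
        ((shellIn π (del2 π S v w') (2 * s₀ + c₀ - 2) (c - g - 2)).card : ℝ)))| ≤
      Bv * (P * T ^ 2) * Kc * (G * q ^ (D' + 1)) := by
    intro v hv w' hw'
    obtain ⟨h3, h4⟩ := hsep v hv w' hw'
    obtain ⟨hst, hcard, h0v, hbv⟩ := hSvw v (mem_inter.1 hv).1 w' (mem_inter.1 hw').1 h3 h4
    have h := piece_abs_le₂ hπ hπ' hdes hst hcard hdisj h0v rfl hbv (s₀ := s₀ - 1) (D' := D') hi₂ hR (by omega)
      (by omega) (fun x₁ x₂ : ℤ => Ψ (x₁ + 1) (x₂ + 1)) (fun _ _ _ => hG _ _)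
      (p * (X - Polynomial.C (g : ℝ)) * (X - Polynomial.C ((g : ℝ) + 1))) hdgg hwgg0 hbase2 hPgg
    rw [← hqdef, ← hKc, show 2 * (s₀ - 1) + c₀ = 2 * s₀ + c₀ - 2 by omega] at h
    simp only [Nat.sub_sub] at h ⊢
    exact h
  -- === sums over the pinned vertices
  have hSpos : (0 : ℝ) < S.card := by linarith only [hScard]
  have hV₁ : ((S ∩ H₁).card : ℝ) ≤ S.card := by exact_mod_cast card_le_card inter_subset_left
  have hV₂ : ((S ∩ H₂).card : ℝ) ≤ S.card := by exact_mod_cast card_le_card inter_subset_left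
  have hD0 : (0 : ℝ) < (S.card : ℝ) * ((S.card : ℝ) - 2) := mul_pos hSpos (by linarith only [hScard])
  have hno₁ : ∀ v ∈ S, ¬ (v ∈ H₁ ∧ π v ∈ H₁) := fun v hv h => hnoHH v hv ⟨mem_union_left _ h.1, mem_union_left _ h.2⟩
  have hno₂ : ∀ v ∈ S, ¬ (v ∈ H₂ ∧ π v ∈ H₂) :=
    fun v hv h => hnoHH v hv ⟨mem_union_right _ h.1, mem_union_right _ h.2⟩
  have hpairs₁ := sum_card_sdiff_pair_le hS H₁ hno₁ (by omega)
  have hpairs₂ := sum_card_sdiff_pair_le hS H₂ hno₂ (by omega)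
  have hcross := sum_card_cross_le hS hdisj hnoHH (by omega)
  obtain ⟨hl4₁, hlk₁, hll₁⟩ := coeff_abs_le hl₁ hkap
  obtain ⟨hl4₂, hlk₂, hll₂⟩ := coeff_abs_le hl₂ hkap
  have hl12 := cross_coeff_abs_le hl₁ hl₂
  have hK3 := abs_div_mul_sum_le (S ∩ H₁) _ (by positivity) hB3 hSpos hV₁ hl4₁
  have hK4 := abs_div_mul_sum_le (S ∩ H₁) _ (by positivity) hB4 hSpos hV₁ hlk₁
  have hK5 := abs_div_mul_sum_le (S ∩ H₁) _ (by positivity) hB5 hSpos hV₁ hll₁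
  have hK6 := abs_div_mul_sum_sum_le (S ∩ H₁) (fun v => (S ∩ H₁) \ {v, π v}) _ (by positivity) hB6 hD0 hpairs₁ hll₁
  have hK3' := abs_div_mul_sum_le (S ∩ H₂) _ (by positivity) hB3' hSpos hV₂ hl4₂
  have hK4' := abs_div_mul_sum_le (S ∩ H₂) _ (by positivity) hB4' hSpos hV₂ hlk₂
  have hK5' := abs_div_mul_sum_le (S ∩ H₂) _ (by positivity) hB5' hSpos hV₂ hll₂
  have hK6' := abs_div_mul_sum_sum_le (S ∩ H₂) (fun v => (S ∩ H₂) \ {v, π v}) _ (by positivity) hB6' hD0 hpairs₂ hll₂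
  have hK7 := abs_div_mul_sum_sum_le (S ∩ H₁) (fun _ => S ∩ H₂) _ (by positivity) hB7 hD0 hcross hl12
  -- === the scalar pieces
  have hK1 : |2 * kap * ∑ c ∈ C, w c * ((p * X).eval (c : ℝ) *
      ((∑ U ∈ shellIn π S (2 * s₀ + c₀) (c - g),
          (fun y₁ y₂ : ℤ => Ψ y₁ y₂ * (2 * l₁ * (y₁ : ℝ) + 2 * l₂ * (y₂ : ℝ) + L))
            ((U ∩ H₁).card : ℤ) ((U ∩ H₂).card : ℤ)) /
        ((shellIn π S (2 * s₀ + c₀) (c - g)).card : ℝ)))| ≤ 2 * (Bv * (P * T) * Kc * (G * Λ₁ * q ^ (D' + 1))) := by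
    rw [abs_mul, abs_mul, abs_of_pos (by norm_num : (0:ℝ) < 2)]
    have : 2 * |kap| ≤ 2 := by linarith only [hkap]
    exact mul_le_mul this hB1 (abs_nonneg _) (by norm_num)
  have hK2 : |kap ^ 2 * ∑ c ∈ C, w c * ((p * X ^ 2).eval (c : ℝ) *
      ((∑ U ∈ shellIn π S (2 * s₀ + c₀) (c - g), Ψ ((U ∩ H₁).card : ℤ) ((U ∩ H₂).card : ℤ)) /
        ((shellIn π S (2 * s₀ + c₀) (c - g)).card : ℝ)))| ≤ 1 * (Bv * (P * T ^ 2) * Kc * (G * q ^ (D' + 1))) := by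
    rw [abs_mul, abs_pow]
    have : |kap| ^ 2 ≤ 1 := pow_le_one₀ (abs_nonneg _) hkap
    exact mul_le_mul this hB2 (abs_nonneg _) (by norm_num)
  -- === assembly
  exact twelve_piece_bound hBv hP0 hKc0 hG0 (pow_nonneg hq0 _) hT0 hΛ₁0 hB0 hK1 hK2 hK3 hK4 hK5 hK6 hK3' hK4' hK5' hK6' hK7

end Main

end Summit.PneNP.PneNP.Theorems.ChebyshevTracialDesignTwoBlock

end
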